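import Mathlib

/-!
# Route `BinomialElusive`, crux `PeelingLemma` (stmt-ValiantsHypothesis-7391) — vocabulary of the
negative lane "deterministic all-X designs" (route-posited object, D-0016 `<RouteSlug>…Defs.lean`)

The refutation blueprint `Cruxes/PeelingLemma/DETERMINISTIC-ALLX.md` builds all-X swallowing designs
from THETA GADGETS whose vertex vectors are WIDE-FIFO WINDOWS along each arm: the arm has an injective
birth sequence `f : ℤ → Λ` (position `t` gives birth to the letter `f t`, which then lives for `2q+1`
steps with alternating sign), and the vertex vector at position `t` is

  `win f q t = Σ_{i=0}^{2q} (-1)^i · e_{f(t-i)}`   (as a function `Λ → ℤ`).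

This is the same object as `fifoVec` of the refuter's workfile `Cruxes/PeelingLemma/Disproof.lean`
(written there over `Finset.Icc (t-2q) t`); it is collected here, under `Theorems/`, so that the helper
files of the lane (`BinomialElusivePeelingLemmaWindowCalculus.lean`: pair-label identity, slot
formula, private top/bottom letters, Lemma E1; later the gadget and local-lemma files) speak about
THE SAME declaration.  Nothing here asserts anything.
-/

-- `Summit.ValiantsHypothesis.ValiantsHypothesis.…` is the tree's mandated single-conjunct layout
-- (Sub = Summit), so the duplicated namespace component is intended.
set_option linter.dupNamespace false

namespace Summit.ValiantsHypothesis.ValiantsHypothesis.Theorems.PeelingLemmaWindow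

open scoped BigOperators

/-- The wide-FIFO window vector at position `t` of an arm with birth sequence `f : ℤ → Λ` and
half-width `q`: the letters `f t, f (t-1), …, f (t-2q)` with alternating signs `+,-,+,…,+`
(`q+1` plus letters, `q` minus letters), `win f q t ν = Σ_{i<2q+1} (-1)^i [f (t-i) = ν]`. -/
def win {Λ : Type*} [DecidableEq Λ] (f : ℤ → Λ) (q : ℕ) (t : ℤ) (ν : Λ) : ℤ :=
  ∑ i ∈ Finset.range (2 * q + 1), (-1) ^ i * (if f (t - i) = ν then 1 else 0)

end Summit.ValiantsHypothesis.ValiantsHypothesis.Theorems.PeelingLemmaWindow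

/-! ## Girth-counting vocabulary (blueprint §4, module [Gir]; appended 2026-08-27 by val-width-7391-p1 g2)

Alternating walks in a letter incidence `Λ : α → Finset β` (gadget `a` carries the letters `Λ a`):
the girth hypothesis `¬ HasShortClosedWalk Λ N` and the finite sets `validWalks` of non-backtracking
walks inside a support incidence, used by `BinomialElusivePeelingLemmaGirthCount.lean`
(`three_pow_le_card`: large girth forces many participating gadgets).  Nothing here asserts anything. -/

namespace Summit.ValiantsHypothesis.ValiantsHypothesis.Theorems.PeelingLemmaGirth

open scoped BigOperators

variable {α β : Type*}

/-- The incidence structure `Λ` (letters of each gadget) has a CLOSED ALTERNATING WALK of some length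
`L` with `1 ≤ L ≤ N` which is non-backtracking at its interior points: gadgets `g 0, …, g L = g 0` and
letters `m 0, …, m (L-1)` with `m i ∈ Λ (g i) ∩ Λ (g (i+1))`, `g i ≠ g (i+1)` (`i < L`) and
`m i ≠ m (i+1)` (`i + 1 < L`).  Its negation is the girth hypothesis of the counting lemma. -/
def HasShortClosedWalk (Λ : α → Finset β) (N : ℕ) : Prop :=
  ∃ L : ℕ, 1 ≤ L ∧ L ≤ N ∧ ∃ (g : ℕ → α) (m : ℕ → β), g L = g 0 ∧
    (∀ i < L, m i ∈ Λ (g i) ∧ m i ∈ Λ (g (i + 1)) ∧ g i ≠ g (i + 1)) ∧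
    (∀ i, i + 1 < L → m i ≠ m (i + 1))

/-- Gadget reached after `i` steps of the walk `w` (steps are (letter, gadget) pairs) from the root
`a₀`; `a₀` itself for `i = 0` (and, irrelevantly, beyond the end). -/
def gadAt (a₀ : α) {r : ℕ} (w : Fin r → β × α) (i : ℕ) : α :=
  if h : 0 < i ∧ i - 1 < r then (w ⟨i - 1, h.2⟩).2 else a₀

/-- Letter used by step `i` of the walk `w` (a default `μ₀` beyond the end). -/
def letAt (μ₀ : β) {r : ℕ} (w : Fin r → β × α) (i : ℕ) : β :=
  if h : i < r then (w ⟨i, h⟩).1 else μ₀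

/-- `w : Fin r → β × α` is a VALID non-backtracking alternating walk of length `r` from `a₀` inside
the support incidences `(P, S)`: step `i` goes from the gadget reached so far to `(w i).2 ∈ P` (a
different gadget) through a letter `(w i).1` supported at both, and consecutive letters differ. -/
def IsValid (S : α → Finset β) (P : Finset α) (a₀ : α) {r : ℕ} (w : Fin r → β × α) :
    Prop :=
  (∀ i : Fin r, (w i).2 ∈ P ∧ (w i).1 ∈ S (gadAt a₀ w i) ∧ (w i).1 ∈ S (w i).2 ∧
      (w i).2 ≠ gadAt a₀ w i) ∧
  (∀ i : Fin r, ∀ h : (i : ℕ) + 1 < r, (w i).1 ≠ (w ⟨i + 1, h⟩).1)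

/-- The finite set of valid walks of length `r` from `a₀`. -/
noncomputable def validWalks [DecidableEq β] (S : α → Finset β) (P : Finset α) (a₀ : α)
    (r : ℕ) : Finset (Fin r → β × α) := by
  classical
  exact (Fintype.piFinset fun _ : Fin r => (P.biUnion S) ×ˢ P).filter (fun w => IsValid S P a₀ w)

end Summit.ValiantsHypothesis.ValiantsHypothesis.Theorems.PeelingLemmaGirth
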